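import Summits.Ventures.HodgeRepro.Tier4.Common.AdelicDefs
import Summits.Ventures.HodgeRepro.Tier4.Line1.PlaneDefs
import Summits.Ventures.HodgeRepro.Tier4.Line1.WittPlane

/-!
# Tier4/Line1/StabLine — LINE L1: the stabiliser of a rational vector acts on its orthogonal line by norm-one scalars
(rung (i) of `hstab`, the R-c′ wall in stabiliser form; t4-L1-p3, lead g385 R-II)

Blind re-derivation cell `pub-hodge-repro`, Tier 4 (README §9–§10).  For a rational `v ≠ 0` and a rational `w ≠ 0` on
the line `v^⊥` (`w ⊥ v`, `wΩ ⊥ v`), every `g ∈ U(W)(𝔸_k)` fixing `v` acts on `w` by an `E′ ⊗ 𝔸_k`-scalar of norm one: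
`w g = x w + y wΩ` with `x² + d y² = 1` (`stab_line_scalar`, row convention of `unitaryGroup`).  Column picture
(`M := gᵀ`, `Om := Ωᵀ`): on the rational adapted basis `S = (v, Om v, w, Om w)` with Gram matrix `diag(α, dα, α′, dα′)`
the conjugate `N = S⁻¹ M S` commutes with `diag(J, J)`, fixes `e₀` and is an isometry of the Gram matrix, which forces
`N = diag(1, 1, ρ)` with `ρ = ρ₁ + ρ₂ J`, `ρ₁² + dρ₂² = 1` (`stab_scalar_of_isometry`).  The residual of the wall `hstab`
is therefore exactly «`{(x, y) ∈ 𝔸_k² : x² + d y² = 1}` modulo its rational points is compact» (Fujisaki for `E′`), a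
statement about `k`, `d` and `𝔸_k` alone.  Mathlib + the line's landed modules only; no printed input.

Nothing here says anything about the status of the Hodge conjecture for CM abelian varieties, which is NOT proved
(HC_CM is NOT proved by anyone in this repository).
-/

set_option autoImplicit false

noncomputable section

namespace Summit.Ventures.HodgeRepro.Tier4.Line1.Rot

open Matrix

variable {k : Type} [Field k] [CharZero k] {R : Type} [CommRing R]

/-- **the stabiliser acts on the orthogonal line by a norm-one scalar** (column picture, over any commutative
`k`-algebra `R` through `ι`): an `Om`-linear `B`-isometry `M` over `R` fixing `ι ∘ v` maps `ι ∘ w` (`w ⊥ v`, `w ⊥ Om v`)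
to `x • (ι ∘ w) + y • (ι ∘ Om w)` with `x² + d y² = 1`. -/
theorem stab_scalar_of_isometry (ι : k →+* R) {B Om : Matrix (Fin 4) (Fin 4) k} {d : k} (hB : Bᵀ = B)
    (hherm : Omᵀ * B = -(B * Om)) (hOm : Om * Om = -(d • (1 : Matrix (Fin 4) (Fin 4) k)))
    (hd : ¬ IsSquare (-d)) (hdef : ∀ u : Fin 4 → k, u ≠ 0 → u ⬝ᵥ (B *ᵥ u) ≠ 0)
    {v w : Fin 4 → k} (hv : v ≠ 0) (hw : w ≠ 0) (hwv : w ⬝ᵥ (B *ᵥ v) = 0)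
    (hwOv : w ⬝ᵥ (B *ᵥ (Om *ᵥ v)) = 0) {M : Matrix (Fin 4) (Fin 4) R}
    (hMOm : M * Om.map ι = Om.map ι * M) (hMB : Mᵀ * B.map ι * M = B.map ι)
    (hMv : M *ᵥ (ι ∘ v) = ι ∘ v) :
    ∃ x y : R, M *ᵥ (ι ∘ w) = x • (ι ∘ w) + y • (ι ∘ (Om *ᵥ w)) ∧ x * x + ι d * (y * y) = 1 := by
  -- the rational adapted basis and its Gram matrix
  have hvw : v ⬝ᵥ (B *ᵥ w) = 0 := by rw [pair_comm hB]; exact hwv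
  have hvOw : v ⬝ᵥ (B *ᵥ (Om *ᵥ w)) = 0 := by
    rw [← neg_eq_zero, ← pair_mulVec_left hherm, pair_comm hB]
    exact hwOv
  set S : Matrix (Fin 4) (Fin 4) k := Matrix.of fun i j => ![v, Om *ᵥ v, w, Om *ᵥ w] j i with hSdef
  set α : k := v ⬝ᵥ (B *ᵥ v) with hαdef
  set α' : k := w ⬝ᵥ (B *ᵥ w) with hα'def
  have hG : Sᵀ * B * S = Matrix.diagonal ![α, d * α, α', d * α'] := gram_adapted hB hherm hOm v w hvw hvOw
  have hα : α ≠ 0 := hdef v hv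
  have hα' : α' ≠ 0 := hdef w hw
  have hd0 : d ≠ 0 := by
    rintro rfl
    exact hd ⟨0, by simp⟩
  have hGdet : (Matrix.diagonal ![α, d * α, α', d * α']).det ≠ 0 := by
    rw [Matrix.det_diagonal, Fin.prod_univ_four]
    simp only [Matrix.cons_val_zero, Matrix.cons_val_one, Matrix.head_cons, Matrix.cons_val_two,
      Matrix.cons_val_three, Matrix.tail_cons]
    exact mul_ne_zero (mul_ne_zero (mul_ne_zero hα (mul_ne_zero hd0 hα)) hα') (mul_ne_zero hd0 hα')
  have hSdet : IsUnit S.det := by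
    rw [isUnit_iff_ne_zero]
    intro h0
    apply hGdet
    rw [← hG, Matrix.det_mul, Matrix.det_mul, Matrix.det_transpose, h0, zero_mul, zero_mul]
  have hSS : S * S⁻¹ = 1 := Matrix.mul_nonsing_inv S hSdet
  have hSS' : S⁻¹ * S = 1 := Matrix.nonsing_inv_mul S hSdet
  have hOmS : Om * S = S * Matrix.of ![![0, -d, 0, 0], ![1, 0, 0, 0], ![0, 0, 0, -d], ![0, 0, 1, 0]] :=
    mul_adapted_eq hOm v w
  -- everything over `R`
  set SR : Matrix (Fin 4) (Fin 4) R := S.map ι with hSR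
  set SR' : Matrix (Fin 4) (Fin 4) R := (S⁻¹).map ι with hSR'
  have hRR : SR * SR' = 1 := by
    rw [hSR, hSR', ← Matrix.map_mul, hSS, Matrix.map_one _ (map_zero ι) (map_one ι)]
  have hRR' : SR' * SR = 1 := by
    rw [hSR, hSR', ← Matrix.map_mul, hSS', Matrix.map_one _ (map_zero ι) (map_one ι)]
  set JR : Matrix (Fin 4) (Fin 4) R :=
    Matrix.of ![![0, -ι d, 0, 0], ![1, 0, 0, 0], ![0, 0, 0, -ι d], ![0, 0, 1, 0]] with hJR
  have hJmap : (Matrix.of ![![0, -d, 0, 0], ![1, 0, 0, 0], ![0, 0, 0, -d], ![0, 0, 1, 0]]).map ι = JR := by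
    ext i j
    fin_cases i <;> fin_cases j <;> simp [JR]
  set GR : Matrix (Fin 4) (Fin 4) R := Matrix.diagonal ![ι α, ι d * ι α, ι α', ι d * ι α'] with hGR
  have hGmap : (Matrix.diagonal ![α, d * α, α', d * α']).map ι = GR := by
    ext i j
    rw [hGR, Matrix.map_apply, Matrix.diagonal_apply, Matrix.diagonal_apply]
    split_ifs with h
    · subst h
      fin_cases i <;> simp
    · simp
  have hGR' : SRᵀ * B.map ι * SR = GR := by
    rw [← hGmap, ← hG, hSR, Matrix.map_mul, Matrix.map_mul, Matrix.transpose_map]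
  have hOmR : Om.map ι * SR = SR * JR := by
    rw [← hJmap, hSR, ← Matrix.map_mul, ← Matrix.map_mul, hOmS]
  -- the conjugate `N`
  set N : Matrix (Fin 4) (Fin 4) R := SR' * M * SR with hNdef
  have hNJ : N * JR = JR * N := by
    have hOm' : Om.map ι = SR * JR * SR' := by
      rw [← hOmR, Matrix.mul_assoc, hRR, Matrix.mul_one]
    calc N * JR = SR' * (M * (SR * JR)) := by rw [hNdef]; simp only [Matrix.mul_assoc]
      _ = SR' * (M * (Om.map ι * SR)) := by rw [hOmR]
      _ = SR' * ((M * Om.map ι) * SR) := by rw [Matrix.mul_assoc]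
      _ = SR' * ((Om.map ι * M) * SR) := by rw [hMOm]
      _ = (SR' * SR) * JR * (SR' * M * SR) := by rw [hOm']; simp only [Matrix.mul_assoc]
      _ = JR * N := by rw [hRR', Matrix.one_mul, hNdef]
  have hNe : N *ᵥ Pi.single 0 1 = Pi.single 0 1 := by
    have h1 : SR *ᵥ Pi.single 0 (1 : R) = ι ∘ v := by
      rw [mulVec_single_one]
      funext i
      simp [SR, hSdef]
    have h2 : SR' *ᵥ (ι ∘ v) = Pi.single 0 1 := by
      rw [← h1, mulVec_mulVec, hRR', one_mulVec]
    rw [hNdef, ← mulVec_mulVec, ← mulVec_mulVec, h1, hMv, h2]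
  have hNG : Nᵀ * GR * N = GR := by
    have hB' : B.map ι = SR'ᵀ * GR * SR' := by
      rw [← hGR']
      calc B.map ι = (SR'ᵀ * SRᵀ) * B.map ι * (SR * SR') := by
            rw [← Matrix.transpose_mul, hRR, Matrix.transpose_one, Matrix.one_mul, Matrix.mul_one]
        _ = SR'ᵀ * (SRᵀ * B.map ι * SR) * SR' := by simp only [Matrix.mul_assoc]
    calc Nᵀ * GR * N = SRᵀ * Mᵀ * (SR'ᵀ * GR * SR') * M * SR := by
          rw [hNdef, Matrix.transpose_mul, Matrix.transpose_mul]
          simp only [Matrix.mul_assoc]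
      _ = SRᵀ * (Mᵀ * B.map ι * M) * SR := by rw [← hB']; simp only [Matrix.mul_assoc]
      _ = GR := by rw [hMB, hGR']
  -- entry extraction
  have hα_u : IsUnit (ι α) := (isUnit_iff_ne_zero.mpr hα).map ι
  have hα'_u : IsUnit (ι α') := (isUnit_iff_ne_zero.mpr hα').map ι
  have hd_u : IsUnit (ι d) := (isUnit_iff_ne_zero.mpr hd0).map ι
  have hcancel : ∀ (u : R), IsUnit u → ∀ z : R, u * z = 0 → z = 0 := by
    intro u hu z h
    obtain ⟨u', rfl⟩ := hu
    simpa using congrArg (fun t => (↑u'⁻¹ : R) * t) h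
  have e0 : N 0 0 = 1 := by have := congrFun hNe 0; simpa [mulVec_single_one] using this
  have e1 : N 1 0 = 0 := by have := congrFun hNe 1; simpa [mulVec_single_one] using this
  have e2 : N 2 0 = 0 := by have := congrFun hNe 2; simpa [mulVec_single_one] using this
  have e3 : N 3 0 = 0 := by have := congrFun hNe 3; simpa [mulVec_single_one] using this
  have hJ : ∀ i j, (N * JR) i j = (JR * N) i j := fun i j => by rw [hNJ]
  have j01 : N 0 1 = 0 := by
    have := hJ 0 0; simp [Matrix.mul_apply, Fin.sum_univ_four, JR, e1] at this; exact this
  have j11 : N 1 1 = 1 := by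
    have := hJ 1 0; simp [Matrix.mul_apply, Fin.sum_univ_four, JR, e0] at this; exact this
  have j21 : N 2 1 = 0 := by
    have := hJ 2 0; simp [Matrix.mul_apply, Fin.sum_univ_four, JR, e3] at this; exact this
  have j31 : N 3 1 = 0 := by
    have := hJ 3 0; simp [Matrix.mul_apply, Fin.sum_univ_four, JR, e2] at this; exact this
  have j03 : N 0 3 = -(ι d * N 1 2) := by
    have := hJ 0 2; simp [Matrix.mul_apply, Fin.sum_univ_four, JR] at this; exact this
  have j13 : N 1 3 = N 0 2 := by
    have := hJ 1 2; simp [Matrix.mul_apply, Fin.sum_univ_four, JR] at this; exact this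
  have j23 : N 2 3 = -(ι d * N 3 2) := by
    have := hJ 2 2; simp [Matrix.mul_apply, Fin.sum_univ_four, JR] at this; exact this
  have j33 : N 3 3 = N 2 2 := by
    have := hJ 3 2; simp [Matrix.mul_apply, Fin.sum_univ_four, JR] at this; exact this
  have hGe : ∀ i j, (Nᵀ * GR * N) i j = GR i j := fun i j => by rw [hNG]
  have g02 : N 0 2 = 0 := by
    have := hGe 0 2
    simp [Matrix.mul_apply, Fin.sum_univ_four, GR, Matrix.diagonal, e0, e1, e2, e3] at this
    refine hcancel (ι α) hα_u _ ?_
    linear_combination this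
  have g12 : N 1 2 = 0 := by
    have := hGe 1 2
    simp [Matrix.mul_apply, Fin.sum_univ_four, GR, Matrix.diagonal, j01, j11, j21, j31] at this
    refine hcancel (ι d * ι α) (hd_u.mul hα_u) _ ?_
    linear_combination this
  have g22 : N 2 2 * N 2 2 + ι d * (N 3 2 * N 3 2) = 1 := by
    have := hGe 2 2
    simp [Matrix.mul_apply, Fin.sum_univ_four, GR, Matrix.diagonal, g02, g12] at this
    have h2 : ι α' * (N 2 2 * N 2 2 + ι d * (N 3 2 * N 3 2)) = ι α' * 1 := by
      rw [mul_one]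
      linear_combination this
    exact hα'_u.mul_left_cancel h2
  refine ⟨N 2 2, N 3 2, ?_, g22⟩
  -- `M (ι ∘ w) = SR (N e₂)`
  have hw2 : SR *ᵥ Pi.single 2 (1 : R) = ι ∘ w := by
    rw [mulVec_single_one]
    funext i
    simp [SR, hSdef]
  have hwOm : SR *ᵥ Pi.single 3 (1 : R) = ι ∘ (Om *ᵥ w) := by
    rw [mulVec_single_one]
    funext i
    simp [SR, hSdef]
  have hM : M = SR * N * SR' := by
    rw [hNdef]
    calc M = (SR * SR') * M * (SR * SR') := by rw [hRR, Matrix.one_mul, Matrix.mul_one]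
      _ = SR * (SR' * M * SR) * SR' := by simp only [Matrix.mul_assoc]
  have hNcol : N *ᵥ Pi.single 2 (1 : R) = N 2 2 • Pi.single 2 1 + N 3 2 • Pi.single 3 1 := by
    rw [mulVec_single_one]
    funext i
    fin_cases i <;> simp [g02, g12]
  have h1 : SR' *ᵥ (ι ∘ w) = Pi.single 2 1 := by
    rw [← hw2, mulVec_mulVec, hRR', one_mulVec]
  calc M *ᵥ (ι ∘ w) = SR *ᵥ (N *ᵥ (SR' *ᵥ (ι ∘ w))) := by
        rw [hM, ← mulVec_mulVec, ← mulVec_mulVec]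
    _ = SR *ᵥ (N 2 2 • Pi.single 2 1 + N 3 2 • Pi.single 3 1) := by rw [h1, hNcol]
    _ = N 2 2 • (ι ∘ w) + N 3 2 • (ι ∘ (Om *ᵥ w)) := by
        rw [mulVec_add, mulVec_smul, mulVec_smul, hw2, hwOm]

end Summit.Ventures.HodgeRepro.Tier4.Line1.Rot

namespace Summit.Ventures.HodgeRepro.Tier4.Line1

open NumberField Summit.Ventures.HodgeRepro.Tier4.Common Matrix

variable {k : Type} [Field k] [NumberField k] (W : PlaneData k)

/-- **rung (i) of `hstab`**: the stabiliser in `U(W)(𝔸_k)` of a non-zero rational row vector `v` acts on the rational line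
`v^⊥` (spanned by `w, wΩ`) by `E′ ⊗ 𝔸_k`-scalars of norm one: `w g = x w + y wΩ` with `x² + d y² = 1`.  The residual of
the wall `hstab` is thus «`{(x, y) ∈ 𝔸_k² : x² + d y² = 1}` modulo its rational points is compact» (Fujisaki). -/
theorem stab_line_scalar (hg : IsGenuineRow W) (hW : IsDefinite W) {d : k}
    (hΩ : W.Ω * W.Ω = -(d • (1 : Matrix (Fin 4) (Fin 4) k))) {v w : Fin 4 → k} (hv : v ≠ 0) (hw : w ≠ 0)
    (hwv : Matrix.vecMul w W.B ⬝ᵥ v = 0) (hwΩv : Matrix.vecMul (Matrix.vecMul w W.Ω) W.B ⬝ᵥ v = 0)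
    (g : GA W)
    (hgv : (fun i => algebraMap k (Ad k) (v i)) ᵥ* GA.mat W g = fun i => algebraMap k (Ad k) (v i)) :
    ∃ x y : Ad k, (fun i => algebraMap k (Ad k) (w i)) ᵥ* GA.mat W g =
        x • (fun i => algebraMap k (Ad k) (w i)) +
          y • ((fun i => algebraMap k (Ad k) (w i)) ᵥ* adMat k W.Ω) ∧
      x * x + algebraMap k (Ad k) d * (y * y) = 1 := by
  obtain ⟨⟨d', hΩ', hd'⟩, hrow, -, -, -, -⟩ := hg
  -- `d` is determined by `Ω`
  have hdd : d = d' := by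
    have h := hΩ.symm.trans hΩ'
    simpa using congrFun (congrFun h 0) 0
  subst hdd
  set ι := algebraMap k (Ad k) with hι
  set M : Matrix (Fin 4) (Fin 4) (Ad k) := (GA.mat W g)ᵀ with hMdef
  have hOm : W.Ωᵀ * W.Ωᵀ = -(d • (1 : Matrix (Fin 4) (Fin 4) k)) := by
    rw [← Matrix.transpose_mul, hΩ, Matrix.transpose_neg, Matrix.transpose_smul, Matrix.transpose_one]
  have hherm : W.Ωᵀᵀ * W.B = -(W.B * W.Ωᵀ) := by
    rw [Matrix.transpose_transpose]
    exact hrow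
  have hdef : ∀ u : Fin 4 → k, u ≠ 0 → u ⬝ᵥ (W.B *ᵥ u) ≠ 0 := fun u hu =>
    pair_self_ne_zero_of_isDefinite W hW hu
  have hwv' : w ⬝ᵥ (W.B *ᵥ v) = 0 := by
    rw [Rot.pair_comm W.B_symm, dotProduct_comm]
    conv_lhs => rw [← W.B_symm]
    rw [mulVec_transpose W.B w]
    exact hwv
  have hwOv' : w ⬝ᵥ (W.B *ᵥ (W.Ωᵀ *ᵥ v)) = 0 := by
    rw [← neg_eq_zero, ← Rot.pair_mulVec_left hherm, Rot.pair_comm W.B_symm, dotProduct_comm]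
    conv_lhs => rw [← W.B_symm]
    rw [mulVec_transpose W.B (W.Ωᵀ *ᵥ w), mulVec_transpose W.Ω w]
    exact hwΩv
  have hMOm : M * W.Ωᵀ.map ι = W.Ωᵀ.map ι * M := by
    have h := ((mem_unitaryGroup W _).mp g.2).1
    simp only [adMat] at h
    rw [hMdef, Matrix.transpose_map, ← Matrix.transpose_mul, ← Matrix.transpose_mul, h]
  have hMB : Mᵀ * W.B.map ι * M = W.B.map ι := by
    rw [hMdef, Matrix.transpose_transpose]
    exact ((mem_unitaryGroup W _).mp g.2).2
  have hMv : M *ᵥ (ι ∘ v) = ι ∘ v := by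
    rw [hMdef, mulVec_transpose]
    exact hgv
  obtain ⟨x, y, hxy, hnorm⟩ := Rot.stab_scalar_of_isometry ι W.B_symm hherm hOm hd' hdef hv hw hwv' hwOv'
    hMOm hMB hMv
  refine ⟨x, y, ?_, hnorm⟩
  have hwΩ : (fun i => ι (w i)) ᵥ* adMat k W.Ω = ι ∘ (W.Ωᵀ *ᵥ w) := by
    funext i
    have := RingHom.map_vecMul ι W.Ω w i
    rw [mulVec_transpose, adMat]
    exact this.symm
  rw [hwΩ, ← mulVec_transpose]
  exact hxy

end Summit.Ventures.HodgeRepro.Tier4.Line1
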